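import Literature.IUT.HodgeArakelov.CohomologyLimitKummerComap

/-!
# Naturality of Kummer classes under EVALUATION: restricting the Kummer class of a "function" `a ∈ A` along a section
# `ι : G_v → Π` equals the `G_v`-level Kummer class of its "value" `ev a ∈ B` — the functoriality half of the
# [IUTchII] Cor 2.8 (i) / Cor 3.5 (ii) theta-evaluation input (E)

S. Mochizuki, *Inter-universal Teichmüller theory II*, kurims Dec-2020 manuscript, Cor 2.8 (i) p. 82 (the classes obtained by
restricting the étale theta class to the decomposition groups of the evaluation points are the Kummer classes of the theta
VALUES), Cor 3.5 (ii) p. 95; S. Mochizuki, *The étale theta function …*, Prop 1.4 (iii) (values at torsion points)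
[cite: Mochizuki2012, Cor 2.8 (i) p.82]. Claim key DISPUTED (D-0012). PROOF-ONLY companion (abc-iut cell, layer L6, seat
abc-iut-w4-d004 gen 3; node **IUTchII:Cor3.5(ii)**, input (E) `hRθ : R_t θ = κ₀ (q_t)`; sub-DAG row Cor-35.ii.r12).
NO definition, NO `Prop` fact, NO instance.

WHY. After this seat's gen-3 files every junction hypothesis of the Cor 3.5 (ii) restriction isomorphism is a theorem at the
genuine data EXCEPT the theta evaluation (E) `R_t θ = κ₀ (q_t)` ("restricting the theta class along the evaluation section `s_t`
gives the Kummer class of the value `q_t`"). (E) factors as (E1) FUNCTORIALITY — restriction along `s_t` of the Kummer class of a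
FUNCTION `f` (an element of a `Π`-module `A` of functions admitting compatible roots) is the `G_v`-level Kummer class of its
VALUE `ev_t f` under a `D_t`-equivariant evaluation `ev_t : A → B` — and (E2) the VALUE of the (root of the) theta function at
the `t`-labelled point (`q^{t²}` up to a unit, [EtTh] Prop 1.4 (ii)/(iii)) together with the identification of the theta class
as the Kummer class of the theta function ([EtTh] Prop 1.3 / Def 1.9; abc-iut-L2 `ThetaKummerClass`). THIS FILE proves (E1)
generically, extending `CohomologyLimitKummerComap.lean` (the case `B = A`, `ev = id`):
* `comap_kummerContClass_map` (fixed level): for `ι : G₀ → G` continuous, an evaluation `ev : A →* B` with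
  `ev (ι g • a) = g • ev a` and coefficient data `c` over `(G, A)`, `c₀` over `(G₀, B)` with `c₀ ∘ Λ(ev) = c`:
  `ContH1.comap ι (κ_A(a)) = κ_B(ev a)` (root system `x ↦ x.map ev`);
* `h1LimComap_h1LimKummer_map` (limits): abc-iut-w4-d004's `h1LimComap ι` carries abc-iut-w4-d007's `h1LimKummer_{G,A}(a)` to
  `h1LimKummer_{G₀,B}(ev a)`; `…KummerOn_map` for submonoids `O ≤ A`, `O' ≤ B` with `ev(O) ≤ O'`;
* `restriction_kummer_eq_kummer_eval` — in the label-wise sections shape of the Cor 3.5 (ii) files (`R = h1LimCongr ∘ (j∘s)^* ∘ ψ`):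
  **`R (κ_A f) = κ₀ (ev f)`** — so (E) for `θ = κ_A(Θ̈-root)` REDUCES to the value identity `ev_t (Θ̈-root) = q_t` (E2), an
  [EtTh] §1 statement, plus the presentation of `θ` as a Kummer class of a function.
Elementary functoriality of `H¹` [cite: NeukirchSchmidtWingberg2008, I §5]; nothing of [IUTchII] is asserted; no side taken on
[IUTchIII] Cor. 3.12; typed ≠ proved ≠ endorsed.
-/

noncomputable section

namespace Literature.IUT.HodgeArakelov

open Literature.AnabelianGeometry.EtaleTheta CohomologySystemOfContH1

/-! ### 1. Fixed level -/

section FixedLevel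

variable {G₀ G G' : Type*} [Group G₀] [TopologicalSpace G₀] [SeparatelyContinuousMul G₀]
  [Group G] [TopologicalSpace G] [SeparatelyContinuousMul G]
  [Group G'] [TopologicalSpace G'] [IsTopologicalGroup G']
  {φ : G →* G'} {A' : Subgroup G'} [A'.Normal] [IsMulCommutative A']
  {A B : Type*} [CommGroup A] [CommGroup B] [MulDistribMulAction G A] [MulDistribMulAction G₀ B]
  [TopologicalSpace A] [TopologicalSpace B]

/-- **Naturality of continuous Kummer classes under evaluation.** For `ι : Π₀ → Π` continuous with `ι(H₀) ≤ H`, an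
`ι`-equivariant "evaluation" `ev : A →* B` (`ev (ι g • a) = g • ev a`), coefficient data `c` over `(Π, A)` and `c₀` over
`(Π₀, B)` with `c₀ ∘ Λ(ev) = c` on cyclotomes: the pull-back along `ι` of the Kummer class of `a` (root system `x`) is the
Kummer class of `ev a` (root system `x.map ev`). [cite: NeukirchSchmidtWingberg2008, I §5] -/
theorem comap_kummerContClass_map (ι : G₀ →* G) (hι : Continuous ι) (ev : A →* B)
    (hev : ∀ (g : G₀) (a : A), ev (ι g • a) = g • ev a)
    (c : CyclotomeCoefficients φ A' A) (c₀ : CyclotomeCoefficients (φ.comp ι) A' B)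
    (hc : ∀ ζ : cyclotome A, c₀.hom (cyclotome.map ev ζ) = c.hom ζ) {H₀ : Subgroup G₀} {H : Subgroup G}
    (hle : H₀.map ι ≤ H) {a : A} (x : RootSystem a) (ha : a ∈ MulAction.fixedPoints H A)
    (hx : ∀ n : ℕ+, IsOpen (MulAction.stabilizer G (x.root n) : Set G))
    (ha₀ : ev a ∈ MulAction.fixedPoints H₀ B)
    (hx₀ : ∀ n : ℕ+, IsOpen (MulAction.stabilizer G₀ ((x.map ev).root n) : Set G₀)) :
    ContH1.comap φ A' ι hι hle (c.kummerContClass H x ha hx) = c₀.kummerContClass H₀ (x.map ev) ha₀ hx₀ := by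
  rw [CyclotomeCoefficients.kummerContClass, CyclotomeCoefficients.kummerContClass, ContH1.comap_mk]
  refine ContH1.mk_congr _ (funext fun y => ?_) _ _
  rw [← hc]
  congr 1
  refine Subtype.ext (funext fun n => ?_)
  rw [cyclotome.map_apply, RootSystem.kummerCocycle_apply, RootSystem.kummerCocycle_apply, RootSystem.map_root,
    Subgroup.smul_def, Subgroup.smul_def, map_div, hev]

end FixedLevel

/-! ### 2. Limits -/

section Limit

variable {P₀ P : TopGroup.{0}} {G' : Type} [Group G'] [TopologicalSpace G'] [IsTopologicalGroup G']
  (φ : P →* G') (A' : Subgroup G') [A'.Normal] [IsMulCommutative A'] (H : Subgroup P)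
  {A B : Type} [CommGroup A] [CommGroup B] [MulDistribMulAction P A] [MulDistribMulAction P₀ B]
  [TopologicalSpace A] [TopologicalSpace B] [RootableBy A ℕ] [RootableBy B ℕ]
  (c : CyclotomeCoefficients φ A' A)
  (hA : ∀ b : A, IsOpen (MulAction.stabilizer P b : Set P))
  (hfi : ∀ b : A, (MulAction.stabilizer P b).FiniteIndex)
  (ι : P₀ →* P) (hι : Continuous ι) {H₀ : Subgroup P₀}

omit [TopologicalSpace A] [TopologicalSpace B] [RootableBy A ℕ] [RootableBy B ℕ] in
/-- `H₀ ∩ ι⁻¹K` fixes the value `ev a` whenever `H ∩ K` fixes `a` (`ev` equivariant along `ι`).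
[cite: NeukirchSchmidtWingberg2008, I §5] -/
theorem mem_fixedPoints_inf_comap_map (hH : H₀.map ι ≤ H) (ev : A →* B)
    (hev : ∀ (g : P₀) (a : A), ev (ι g • a) = g • ev a) (i : Idx (P := P) ⊥) {a : A}
    (ha : a ∈ MulAction.fixedPoints ↥(H ⊓ i.K) A) :
    ev a ∈ MulAction.fixedPoints ↥(H₀ ⊓ (Idx.comap ι hι i).K) B := by
  intro h
  rw [Subgroup.smul_def, ← hev]
  exact congrArg ev (ha ⟨ι (h : P₀), hH ⟨(h : P₀), h.2.1, rfl⟩, h.2.2⟩)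

/-- **Naturality of the limit Kummer map under evaluation**: abc-iut-w4-d004's `h1LimComap ι` carries abc-iut-w4-d007's
Kummer class `κ_{Π,A}(a)` to `κ_{Π₀,B}(ev a)` for an `ι`-equivariant evaluation `ev : A →* B` and coefficient data with
`c₀ ∘ Λ(ev) = c` — computed at the level `Stab_Π(a)` and its pull-back, with the root systems `x`, `x.map ev`.
[cite: NeukirchSchmidtWingberg2008, I §5] -/
theorem h1LimComap_h1LimKummer_map (hH : H₀.map ι ≤ H) (ev : A →* B)
    (hev : ∀ (g : P₀) (a : A), ev (ι g • a) = g • ev a)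
    (c₀ : CyclotomeCoefficients (φ.comp ι) A' B) (hc : ∀ ζ : cyclotome A, c₀.hom (cyclotome.map ev ζ) = c.hom ζ)
    (hB₀ : ∀ b : B, IsOpen (MulAction.stabilizer P₀ b : Set P₀))
    (hfi₀ : ∀ b : B, (MulAction.stabilizer P₀ b).FiniteIndex) (a : A) :
    h1LimComap φ A' ι hι hH (Multiplicative.toAdd (h1LimKummer φ A' H c hA hfi a)) =
      Multiplicative.toAdd (h1LimKummer (φ.comp ι) A' H₀ c₀ hB₀ hfi₀ (ev a)) := by
  have ha := mem_fixedPoints_stabIdx H hA hfi a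
  have ha₀ := mem_fixedPoints_inf_comap_map H ι hι hH ev hev (stabIdx hA hfi a) ha
  rw [h1LimKummer_eq_h1Of_kummerContClass φ A' H c hA hfi a (stabIdx hA hfi a) ha (RootSystem.ofRootableBy a),
    h1LimKummer_eq_h1Of_kummerContClass (φ.comp ι) A' H₀ c₀ hB₀ hfi₀ (ev a) (Idx.comap ι hι (stabIdx hA hfi a)) ha₀
      ((RootSystem.ofRootableBy a).map ev),
    toAdd_ofAdd, toAdd_ofAdd, h1LimComap_of]
  refine congrArg (h1Of (φ.comp ι) A' H₀ ⊥ (Idx.comap ι hι (stabIdx hA hfi a))) ?_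
  change Additive.ofMul (ContH1.comap φ A' ι hι (inf_comap_map_le ι hι hH (stabIdx hA hfi a))
      (c.kummerContClass (H ⊓ (stabIdx hA hfi a).K) (RootSystem.ofRootableBy a) ha fun _ => hA _)) = _
  rw [comap_kummerContClass_map ι hι ev hev c c₀ hc (inf_comap_map_le ι hι hH (stabIdx hA hfi a))
    (RootSystem.ofRootableBy a) ha (fun _ => hA _) ha₀ (fun _ => hB₀ _)]

/-- The same for Kummer maps restricted to submonoids `O ≤ A`, `O' ≤ B` with `ev(O) ⊆ O'` (`h1LimKummerOn`; e.g. `O` a monoid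
of integral functions and `O' = 𝒪^▷` the constants of positive valuation). [cite: Mochizuki2012, Cor 2.8 (i) p.82] -/
theorem h1LimComap_h1LimKummerOn_map (hH : H₀.map ι ≤ H) (ev : A →* B)
    (hev : ∀ (g : P₀) (a : A), ev (ι g • a) = g • ev a)
    (c₀ : CyclotomeCoefficients (φ.comp ι) A' B) (hc : ∀ ζ : cyclotome A, c₀.hom (cyclotome.map ev ζ) = c.hom ζ)
    (hB₀ : ∀ b : B, IsOpen (MulAction.stabilizer P₀ b : Set P₀))
    (hfi₀ : ∀ b : B, (MulAction.stabilizer P₀ b).FiniteIndex)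
    (O : Submonoid A) (O' : Submonoid B) (hOO' : ∀ f : O, ev f ∈ O') (f : O) :
    h1LimComap φ A' ι hι hH (Multiplicative.toAdd (h1LimKummerOn φ A' H c hA hfi O f)) =
      Multiplicative.toAdd (h1LimKummerOn (φ.comp ι) A' H₀ c₀ hB₀ hfi₀ O' ⟨ev f, hOO' f⟩) := by
  rw [h1LimKummerOn_apply, h1LimKummerOn_apply]
  exact h1LimComap_h1LimKummer_map φ A' H c hA hfi ι hι hH ev hev c₀ hc hB₀ hfi₀ f

end Limit

/-! ### 3. (E1) in the label-wise sections shape of the [IUTchII] Cor 3.5 (ii) files -/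

section Labelwise

open TemperedThetaMonoids

variable {Q : Type} [Group Q] (E : TemperedThetaMonoids.ThetaEnvData.{0, 0} Q)
  {P₀ P : TopGroup.{0}} {G' : Type} [Group G'] [TopologicalSpace G'] [IsTopologicalGroup G']
  (φ : P →* G') (φ₀ : P₀ →* G') (Am : Subgroup G') [Am.Normal] [IsMulCommutative Am] (N : Subgroup P)
  {A B : Type} [CommGroup A] [CommGroup B] [MulDistribMulAction P A] [MulDistribMulAction P₀ B]
  [TopologicalSpace A] [TopologicalSpace B] [RootableBy A ℕ] [RootableBy B ℕ]
  (c : CyclotomeCoefficients φ Am A)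
  (hA : ∀ b : A, IsOpen (MulAction.stabilizer P b : Set P))
  (hfi : ∀ b : A, (MulAction.stabilizer P b).FiniteIndex)
  (c₀ : CyclotomeCoefficients φ₀ Am B)
  (hB₀ : ∀ b : B, IsOpen (MulAction.stabilizer P₀ b : Set P₀))
  (hfi₀ : ∀ b : B, (MulAction.stabilizer P₀ b).FiniteIndex)
  (O' : Submonoid B)
  (j : Q →* P) (ψ : Additive E.H ≃+ h1Lim φ Am N ⊥) (s : P₀ →* Q)
  (hι : Continuous (j.comp s)) (hN : (⊤ : Subgroup P₀).map (j.comp s) ≤ N) (hφ : φ.comp (j.comp s) = φ₀)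

omit [IsTopologicalGroup G'] [IsMulCommutative Am] [RootableBy A ℕ] [RootableBy B ℕ] in
include hφ in
/-- Coefficient data over `G_v` for the pulled-back action `φ ∘ j ∘ s` on the VALUE module `B`, with underlying homomorphism
that of `c₀` — exists when `c₀` is `φ₀`-equivariant and `φ ∘ j ∘ s = φ₀` (bookkeeping for the transport `h1LimCongr`).
[cite: NeukirchSchmidtWingberg2008, I §5] -/
theorem exists_cyclotomeCoefficients_eval :
    ∃ ct : CyclotomeCoefficients (φ.comp (j.comp s)) Am B, ∀ ζ, ct.hom ζ = c₀.hom ζ := by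
  refine ⟨⟨c₀.hom, c₀.continuous_hom, fun g ζ => ?_⟩, fun _ => rfl⟩
  rw [c₀.hom_smul]
  have h : (φ.comp (j.comp s)) g = φ₀ g := by rw [hφ]
  rw [h]

/-- **(E1) «restriction along an evaluation section of the Kummer class of a function = the `G_v`-level Kummer class of
its value»** in the label-wise sections shape of the Cor 3.5 (ii) files: with `R = h1LimCongr ∘ (j∘s)^* ∘ ψ`, the record's
ambient module identified (`ψ`) with the genuine limit over `Π`, an element `θ ∈ E.H` PRESENTED as the Kummer class of a
"function" `f ∈ A` (`hθ : ψ θ = κ_A(f)`), and an evaluation `ev : A →* B` equivariant along the section (`hev`) with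
`c₀ ∘ Λ(ev) = c`: `R θ = κ₀ (ev f)` where `κ₀ := h1LimKummer` over `G_v`. So the Cor 3.5 (ii) input (E) `R_t θ = κ₀ (q_t)`
reduces to the VALUE identity `ev_t f = q_t` ([EtTh] Prop 1.4 (iii)) for a presentation of `θ` as a Kummer class of a
function. [cite: Mochizuki2012, Cor 2.8 (i) p.82] -/
theorem restriction_kummer_eq_kummer_eval (ev : A →* B) (hev : ∀ (g : P₀) (a : A), ev (j (s g) • a) = g • ev a)
    (hc : ∀ ζ : cyclotome A, c₀.hom (cyclotome.map ev ζ) = c.hom ζ)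
    (R : E.H →* Multiplicative (h1Lim φ₀ Am (⊤ : Subgroup P₀) ⊥))
    (hR : ∀ y, Multiplicative.toAdd (R y) =
      h1LimCongr Am ⊤ hφ ⊥ (h1LimComap φ Am (j.comp s) hι hN (ψ (Additive.ofMul y))))
    {θ : E.H} {f : A} (hθ : ψ (Additive.ofMul θ) = Multiplicative.toAdd (h1LimKummer φ Am N c hA hfi f)) :
    R θ = h1LimKummer φ₀ Am ⊤ c₀ hB₀ hfi₀ (ev f) := by
  obtain ⟨ct, hct⟩ := exists_cyclotomeCoefficients_eval φ φ₀ Am c₀ j s hφ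
  apply Multiplicative.toAdd.injective
  rw [hR, hθ, h1LimComap_h1LimKummer_map φ Am N c hA hfi (j.comp s) hι hN ev hev ct
    (fun ζ => (hct _).trans (hc ζ)) hB₀ hfi₀ f]
  exact h1LimCongr_h1LimKummer Am ⊤ hB₀ hfi₀ hφ ct c₀ hct (ev f)

end Labelwise

end Literature.IUT.HodgeArakelov

end
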